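import Summits.QuantumAdvantage.QuantumAdvantage.Theses.KummerSector

/-!
# Route `KummerSector`: the `Assembly` item (stmt-QuantumAdvantage-1620)

The assembly item of route `KummerSector` is pure logic: `KsMemBQP` (Kummer's language is in `BQP`) and `KsThesis` (it is not in `BPP`) give the witness of `QuantumAdvantage = ∃ L ∈ BQP, L ∉ BPP`.
HONEST FRAMING (block-2b rule): a closed ledger item (settled-trivial), NOT summit progress — the route's
cruxes are untouched.
-/

set_option linter.dupNamespace false -- D-0017: single-problem summit ⇒ `QuantumAdvantage.QuantumAdvantage` by design

namespace Summit.QuantumAdvantage.QuantumAdvantage.Theorems.KummerSector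

/-- **`KummerSector.Assembly`** (stmt-QuantumAdvantage-1620): pure logic. [folklore] -/
theorem Assembly_proof : Summit.QuantumAdvantage.QuantumAdvantage.Theses.KummerSector.Assembly := by
  unfold Summit.QuantumAdvantage.QuantumAdvantage.Theses.KummerSector.Assembly
  exact fun h₁ h₂ => ⟨_, h₁, h₂⟩

end Summit.QuantumAdvantage.QuantumAdvantage.Theorems.KummerSector
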